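import Summits.CriticalPhenomena.PercolationContinuityZ3.Theorems.PercGamblersRuinVerticalGamblersRuinStubFourthMoment

/-!
# Route `PercGamblersRuin`, crux `VerticalGamblersRuin` (stmt-CriticalPhenomena-10642):
# stub `stub_diagonalTerms` — diagonal terms of the annealed variance of the corrector-shifted height

Helper file for the stub `stub_diagonalTerms` of the line `registered` (skeleton rev 10, Theorem
A(i), diagonal terms) of the crux `PercGamblersRuin.VerticalGamblersRuin`.

Setting.  Bond configurations `ω` on `ℤ³` under `P = P_{p_c}`; `N_ω(x)` is the set of lattice
neighbours `y ∼ x` with `s(x, y)` open in `ω`, `deg_ω(0) = #N_ω(0)`;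
`ω - x = BondConfig.relabel (sym2Equiv (Site.shift (-x))) ω` is the configuration seen from `x`
(entering as `sh`, pinned by `hsh`); `𝒫_ω` is the unkilled one-step averaging operator (pinned by
`hPop`) and `E ω T x G = E^ω_x[G [X_0, …, X_T]]` the path functional of the simple random walk on
the open lattice edges (pinned by its first-step recursion `hE0`/`hEs`).  For a bounded measurable
`ψ : Ω → ℝ` the corrector-shifted height is `Ψ_ω(x) = x₀ + ψ(ω - x)` and its Dirichlet energy is
`F̃(ψ) = ∫_{0↔∞} ∑_{y ∈ N_ω(0)} (y₀ + ψ(ω - y) - ψ(ω))² dP`.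

Statement proved (exact registered signature): for `i < T`,
`∫_{0↔∞} deg_ω(0) · E ω T 0 ((Ψ(X_{i+1}) - Ψ(X_i))²) dP = F̃(ψ)` — every increment of the
corrector-shifted height along the degree-biased annealed walk has second moment `F̃(ψ)`.

Proof.  (1) PREFIX: the functional only depends on `X_0, …, X_{i+1}`, and the walk started at a
site with an open neighbour never loses mass (`StubForwardKolmogorov.mass_one`), so
`E ω T 0 (…) = E ω (i+1) 0 (…)` (`prefix_eq`; if `deg_ω(0) = 0` both sides of the identity
vanish).  (2) LAST STEP (`StubPathReversal.succ_eq_last`): conditioning on `X_i = z`, the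
functional becomes `(∑_{y ∈ N_ω(z)} (y₀ + ψ(ω-y) - z₀ - ψ(ω-z))²) / #N_ω(z) = g₂(ω - z)` with
`g₂(ω') = (∑_{w ∈ N_{ω'}(0)} (w₀ + ψ(ω'-w) - ψ(ω'))²) / deg_{ω'}(0)` (SHIFT COVARIANCE:
`N_ω(z) = N_{ω-z}(0) + z`, `(ω - z) - w = ω - (w + z)`).  (3) LINK `E ω i 0 (l ↦ f(l_i)) =
(𝒫_ω^i f)(0)` (`StubPathFunctionalBasics.iterate_full`) and STATIONARITY of the degree-biased
cluster law (`stub_stationarity`, applied to `g₂ / M ∈ [0, 1]`, `M = (1 + 2B)² + 1`):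
`∫ deg·(𝒫^i (x ↦ g₂(ω-x)))(0) = ∫ deg·g₂`.  (4) `deg_ω(0)·g₂(ω) = ∑_{w ∈ N_ω(0)} (…)²`.

## References

* C. Kipnis, S. R. S. Varadhan, *Central limit theorem for additive functionals of reversible
  Markov processes and applications to simple exclusions*, Comm. Math. Phys. 104 (1986), 1–19,
  §1 (the Dirichlet form of the environment process).
* A. De Masi, P. A. Ferrari, S. Goldstein, W. D. Wick, *An invariance principle for reversible
  Markov processes. Applications to random motions in random environments*, J. Statist. Phys.
  55 (1989), 787–855, §4 (the environment seen from the walker on the cluster).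
* R. Lyons, Y. Peres, *Probability on Trees and Networks*, Cambridge University Press (2016),
  §2.1 (path expectations of network random walks, first-step recursion).
-/

noncomputable section

namespace Summit.CriticalPhenomena.PercolationContinuityZ3.Theorems.VerticalGamblersRuin

open MeasureTheory Filter Topology
open Literature.Probability.Percolation Literature.Probability.LatticeModels
open scoped Classical

namespace StubDiagonalTerms

/-! ### List bookkeeping -/

/-- Truncating a list to its first `n` entries does not change the entries before position `n`. -/
theorem getD_take_of_lt {α : Type*} (l : List α) (d : α) {j n : ℕ} (h : j < n) :
    (l.take n).getD j d = l.getD j d := by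
  rw [List.getD_eq_getElem?_getD, List.getD_eq_getElem?_getD, List.getElem?_take_of_lt h]

/-- The last element of a list of length `i + 1` is its entry at position `i`. -/
theorem getLastD_eq_getD {α : Type*} {l : List α} {i : ℕ} (hl : l.length = i + 1) (d : α) :
    l.getLastD d = l.getD i d := by
  rw [List.getLastD_eq_getLast?, List.getLast?_eq_getElem?, List.getD_eq_getElem?_getD, hl,
    Nat.add_sub_cancel]

/-- Appending one element to a list of length `i + 1` does not change the entry at position `i`. -/
theorem getD_concat_of_length {α : Type*} {l : List α} {i : ℕ} (hl : l.length = i + 1)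
    (y d : α) : (l ++ [y]).getD i d = l.getD i d :=
  List.getD_append l [y] d i (by omega)

/-- Appending one element to a list of length `i + 1`: the entry at position `i + 1` is the
appended element. -/
theorem getD_concat_length {α : Type*} {l : List α} {i : ℕ} (hl : l.length = i + 1) (y d : α) :
    (l ++ [y]).getD (i + 1) d = y := by
  rw [List.getD_append_right l [y] d (i + 1) (by omega), hl, Nat.sub_self, List.getD_cons_zero]

/-! ### The path functional pinned by its first-step recursion: prefix property, last step -/

section Abstract

variable {V : Type*} {v₀ : V} {N : V → Finset V} {F : ℕ → V → (List V → ℝ) → ℝ}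

/-- **Prefix property.**  For a symmetric neighbour structure `N` and a path functional `F`
pinned by the first-step recursion: if `G` only depends on the first `k + 1` sites of the path,
then `F (k + m) x G = F k x G` from every start `x` with `N x ≠ ∅` (the walk never loses mass
after time `0`; induction on `k`, `StubForwardKolmogorov.mass_one` at `k = 0`). -/
theorem prefix_eq (hF0 : ∀ x G, F 0 x G = G [x])
    (hFs : ∀ T x G, F (T + 1) x G = (∑ y ∈ N x, F T y (fun l => G (x :: l))) / ((N x).card : ℝ))
    (hsymm : ∀ x y, y ∈ N x → x ∈ N y) (m k : ℕ) :
    ∀ (x : V) (G : List V → ℝ), (N x).Nonempty → (∀ l, G l = G (l.take (k + 1))) →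
      F (k + m) x G = F k x G := by
  induction k with
  | zero =>
    intro x G hx hG
    rw [Nat.zero_add, hF0]
    have h1 : F m x G = F m x (fun _ => G [x] * 1) :=
      StubPathFunctionalBasics.congr_path (v₀ := x) hF0 hFs m x fun l hl h0 => by
        obtain ⟨a, l', rfl⟩ := List.exists_cons_of_ne_nil (List.ne_nil_of_length_eq_add_one hl)
        rw [List.getD_cons_zero] at h0
        rw [hG, List.take_succ_cons, List.take_zero, h0, mul_one]
    rw [h1, StubPathFunctionalBasics.smul hF0 hFs m x (G [x]) fun _ => 1,
      StubForwardKolmogorov.mass_one hF0 hFs hsymm m x hx, mul_one]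
  | succ k ih =>
    intro x G hx hG
    rw [show k + 1 + m = k + m + 1 by omega, hFs, hFs]
    refine congrArg (· / _) (Finset.sum_congr rfl fun y hy => ih y _ ⟨x, hsymm x y hy⟩ fun l => ?_)
    have h := hG (x :: l)
    rwa [List.take_succ_cons] at h

/-- **Last step for a pair functional.**  For a functional of the sites at times `i` and `i + 1`
only, `F (i + 1) x (l ↦ Φ l_i l_{i+1}) = F i x (l ↦ (∑_{y ∈ N l_i} Φ l_i y) / #N l_i)`
(`StubPathReversal.succ_eq_last`: on paths of length `i + 1` the last site is `l_i`). -/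
theorem succ_eq_pair (hF0 : ∀ x G, F 0 x G = G [x])
    (hFs : ∀ T x G, F (T + 1) x G = (∑ y ∈ N x, F T y (fun l => G (x :: l))) / ((N x).card : ℝ))
    (i : ℕ) (x : V) (Φ : V → V → ℝ) :
    F (i + 1) x (fun l => Φ (l.getD i v₀) (l.getD (i + 1) v₀)) =
      F i x (fun l => (∑ y ∈ N (l.getD i v₀), Φ (l.getD i v₀) y) /
        ((N (l.getD i v₀)).card : ℝ)) := by
  rw [StubPathReversal.succ_eq_last hF0 hFs v₀ i x]
  refine StubPathFunctionalBasics.congr_path (v₀ := v₀) hF0 hFs i x fun l hl _ => ?_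
  simp only [getLastD_eq_getD hl, getD_concat_of_length hl, getD_concat_length hl]

end Abstract

/-! ### The one-step functional `g₂`: shift covariance, measurability, bounds -/

/-- **Shift covariance of the squared increment.**  For every site `z`,
`g₂(ω - z) = (∑_{y ∈ N_ω(z)} (y₀ + ψ(ω - y) - (z₀ + ψ(ω - z)))²) / #N_ω(z)` where
`g₂(ω') = (∑_{w ∈ N_{ω'}(0)} (w₀ + ψ(ω' - w) - ψ(ω'))²) / #N_{ω'}(0)`: reindex the open
neighbours of `z` in `ω` as `y = w + z` with `w` an open neighbour of `0` in `ω - z`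
(`StubStationarity.mem_filter_relabel_shift_neg_iff`) and use `(ω - z) - w = ω - (w + z)`. -/
theorem sumSq_div_seen_from (ψ : BondConfig (Site 3) → ℝ) (ω : BondConfig (Site 3))
    (z : Site 3) :
    (∑ y ∈ ((zdGraph 3).neighborFinset z).filter (fun y => s(z, y) ∈ ω),
        (((y 0 : ℤ) : ℝ) + ψ (BondConfig.relabel (sym2Equiv (Site.shift (-y))) ω) -
          (((z 0 : ℤ) : ℝ) + ψ (BondConfig.relabel (sym2Equiv (Site.shift (-z))) ω))) ^ 2) /
      ((((zdGraph 3).neighborFinset z).filter (fun y => s(z, y) ∈ ω)).card : ℝ) =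
    (∑ w ∈ ((zdGraph 3).neighborFinset (0 : Site 3)).filter (fun w => s((0 : Site 3), w) ∈
        BondConfig.relabel (sym2Equiv (Site.shift (-z))) ω),
        (((w 0 : ℤ) : ℝ) +
            ψ (BondConfig.relabel (sym2Equiv (Site.shift (-w)))
              (BondConfig.relabel (sym2Equiv (Site.shift (-z))) ω)) -
          ψ (BondConfig.relabel (sym2Equiv (Site.shift (-z))) ω)) ^ 2) /
      ((((zdGraph 3).neighborFinset (0 : Site 3)).filter (fun w => s((0 : Site 3), w) ∈
        BondConfig.relabel (sym2Equiv (Site.shift (-z))) ω)).card : ℝ) := by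
  symm
  refine congrArg₂ (· / ·) (Finset.sum_equiv (Site.shift z)
    (fun w => StubStationarity.mem_filter_relabel_shift_neg_iff z ω w) fun w _ => ?_)
    (congrArg Nat.cast (Finset.card_equiv (Site.shift z)
      fun w => StubStationarity.mem_filter_relabel_shift_neg_iff z ω w))
  rw [StubStationarity.relabel_shift_neg_relabel_shift_neg, Site.shift_apply, Pi.add_apply,
    Int.cast_add]
  ring

/-- **Measurability of `g₂`** (a finite sum over the six lattice neighbours of `0` of indicators
of one-edge events times measurable functions, divided by the measurable degree; cf.
`StubStationarity.measurable_pop_zero`). -/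
theorem measurable_sumSq_div {ψ : BondConfig (Site 3) → ℝ} (hψ : Measurable ψ) :
    Measurable fun ω : BondConfig (Site 3) =>
      (∑ w ∈ ((zdGraph 3).neighborFinset (0 : Site 3)).filter (fun w => s((0 : Site 3), w) ∈ ω),
          (((w 0 : ℤ) : ℝ) + ψ (BondConfig.relabel (sym2Equiv (Site.shift (-w))) ω) - ψ ω) ^ 2) /
        ((((zdGraph 3).neighborFinset (0 : Site 3)).filter
          (fun w => s((0 : Site 3), w) ∈ ω)).card : ℝ) := by
  refine Measurable.div ?_ StubStationarity.measurable_card_filter_zero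
  have h : (fun ω : BondConfig (Site 3) =>
      ∑ w ∈ ((zdGraph 3).neighborFinset (0 : Site 3)).filter (fun w => s((0 : Site 3), w) ∈ ω),
        (((w 0 : ℤ) : ℝ) + ψ (BondConfig.relabel (sym2Equiv (Site.shift (-w))) ω) - ψ ω) ^ 2) =
      fun ω => ∑ w ∈ (zdGraph 3).neighborFinset (0 : Site 3),
        if s((0 : Site 3), w) ∈ ω then
          (((w 0 : ℤ) : ℝ) + ψ (BondConfig.relabel (sym2Equiv (Site.shift (-w))) ω) - ψ ω) ^ 2
        else 0 := by
    funext ω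
    rw [Finset.sum_filter]
  rw [h]
  refine Finset.measurable_sum _ fun w _ => ?_
  exact Measurable.ite (measurableSet_mem (s((0 : Site 3), w) : Sym2 (Site 3)))
    (((measurable_const.add
      (hψ.comp (BondConfig.relabel (sym2Equiv (Site.shift (-w)))).measurable)).sub hψ).pow_const 2)
    measurable_const

/-- **Bounds on `g₂`**: `0 ≤ g₂ ≤ (1 + 2B)²` when `|ψ| ≤ B` (an average of squares of numbers of
modulus at most `|w₀| + 2B ≤ 1 + 2B`, `w` a lattice neighbour of `0`). -/
theorem sumSq_div_mem_Icc {ψ : BondConfig (Site 3) → ℝ} {B : ℝ} (hψb : ∀ ω, |ψ ω| ≤ B)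
    (ω : BondConfig (Site 3)) :
    0 ≤ (∑ w ∈ ((zdGraph 3).neighborFinset (0 : Site 3)).filter (fun w => s((0 : Site 3), w) ∈ ω),
          (((w 0 : ℤ) : ℝ) + ψ (BondConfig.relabel (sym2Equiv (Site.shift (-w))) ω) - ψ ω) ^ 2) /
        ((((zdGraph 3).neighborFinset (0 : Site 3)).filter
          (fun w => s((0 : Site 3), w) ∈ ω)).card : ℝ) ∧
      (∑ w ∈ ((zdGraph 3).neighborFinset (0 : Site 3)).filter (fun w => s((0 : Site 3), w) ∈ ω),
          (((w 0 : ℤ) : ℝ) + ψ (BondConfig.relabel (sym2Equiv (Site.shift (-w))) ω) - ψ ω) ^ 2) /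
        ((((zdGraph 3).neighborFinset (0 : Site 3)).filter
          (fun w => s((0 : Site 3), w) ∈ ω)).card : ℝ) ≤ (1 + 2 * B) ^ 2 := by
  refine ⟨div_nonneg (Finset.sum_nonneg fun w _ => sq_nonneg _) (Nat.cast_nonneg _),
    div_le_of_le_mul₀ (Nat.cast_nonneg _) (sq_nonneg _) ?_⟩
  refine (Finset.sum_le_card_nsmul _ _ _ fun w hw => ?_).trans_eq (by rw [nsmul_eq_mul, mul_comm])
  have hadj : (zdGraph 3).Adj (0 : Site 3) w :=
    (SimpleGraph.mem_neighborFinset _ _ _).1 (Finset.mem_filter.1 hw).1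
  have h1 : w 0 ≤ 0 + 1 := SlabVoltage.apply_zero_le_of_adj hadj
  have h2 : 0 ≤ w 0 + 1 := SlabVoltage.apply_zero_le_of_adj hadj.symm
  have hw1 : ((w 0 : ℤ) : ℝ) ≤ 1 := by exact_mod_cast (by omega : w 0 ≤ 1)
  have hw2 : (-1 : ℝ) ≤ ((w 0 : ℤ) : ℝ) := by exact_mod_cast (by omega : -1 ≤ w 0)
  obtain ⟨hA1, hA2⟩ := abs_le.1 (hψb (BondConfig.relabel (sym2Equiv (Site.shift (-w))) ω))
  obtain ⟨hB1, hB2⟩ := abs_le.1 (hψb ω)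
  exact sq_le_sq' (by linarith) (by linarith)

/-! ### The last step on the lattice -/

/-- **Last step at time `i + 1`, with shift covariance.**  For the squared increment of the
corrector-shifted height between times `i` and `i + 1`:
`E ω (i+1) 0 ((Ψ(l_{i+1}) - Ψ(l_i))²) = E ω i 0 (l ↦ g₂(ω - l_i))` (`succ_eq_pair` and
`sumSq_div_seen_from`). -/
theorem last_step {E : BondConfig (Site 3) → ℕ → Site 3 → (List (Site 3) → ℝ) → ℝ}
    (hE0 : ∀ ω (x : Site 3) (G : List (Site 3) → ℝ), E ω 0 x G = G [x])
    (hEs : ∀ ω (T : ℕ) (x : Site 3) (G : List (Site 3) → ℝ), E ω (T + 1) x G =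
      (∑ y ∈ ((zdGraph 3).neighborFinset x).filter (fun y => s(x, y) ∈ ω),
          E ω T y (fun l => G (x :: l))) /
        ((((zdGraph 3).neighborFinset x).filter (fun y => s(x, y) ∈ ω)).card : ℝ))
    (ψ : BondConfig (Site 3) → ℝ) (ω : BondConfig (Site 3)) (i : ℕ) :
    E ω (i + 1) 0 (fun l =>
        ((((l.getD (i + 1) 0) 0 : ℤ) : ℝ) +
            ψ (BondConfig.relabel (sym2Equiv (Site.shift (-(l.getD (i + 1) 0)))) ω) -
          ((((l.getD i 0) 0 : ℤ) : ℝ) +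
            ψ (BondConfig.relabel (sym2Equiv (Site.shift (-(l.getD i 0)))) ω))) ^ 2) =
      E ω i 0 (fun l =>
        (∑ w ∈ ((zdGraph 3).neighborFinset (0 : Site 3)).filter (fun w => s((0 : Site 3), w) ∈
            BondConfig.relabel (sym2Equiv (Site.shift (-(l.getD i 0)))) ω),
          (((w 0 : ℤ) : ℝ) +
              ψ (BondConfig.relabel (sym2Equiv (Site.shift (-w)))
                (BondConfig.relabel (sym2Equiv (Site.shift (-(l.getD i 0)))) ω)) -
            ψ (BondConfig.relabel (sym2Equiv (Site.shift (-(l.getD i 0)))) ω)) ^ 2) /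
        ((((zdGraph 3).neighborFinset (0 : Site 3)).filter (fun w => s((0 : Site 3), w) ∈
            BondConfig.relabel (sym2Equiv (Site.shift (-(l.getD i 0)))) ω)).card : ℝ)) := by
  refine (succ_eq_pair (v₀ := (0 : Site 3)) (hE0 ω) (hEs ω) i 0 (fun a b : Site 3 =>
    (((b 0 : ℤ) : ℝ) + ψ (BondConfig.relabel (sym2Equiv (Site.shift (-b))) ω) -
      (((a 0 : ℤ) : ℝ) + ψ (BondConfig.relabel (sym2Equiv (Site.shift (-a))) ω))) ^ 2)).trans ?_
  exact congrArg (E ω i 0) (funext fun l => sumSq_div_seen_from ψ ω (l.getD i 0))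

end StubDiagonalTerms

open StubDiagonalTerms in
/-- **Stub `stub_diagonalTerms`** of the crux `VerticalGamblersRuin` (line `registered`, rev 10;
exact registered signature): **Theorem A(i), diagonal terms — each increment of the
corrector-shifted height has annealed second moment `F̃(ψ)`.**  With `ω - x` the configuration
seen from `x` (entering as `sh`, pinned by `hsh`), `𝒫_ω` the unkilled one-step averaging operator
(pinned by `hPop`), `E ω T x G = E^ω_x[G [X_0, …, X_T]]` the path functional of the SRW on the open
lattice edges (pinned by `hE0`/`hEs`), a bounded measurable `ψ` and `Ψ_ω(x) = x₀ + ψ(ω - x)`: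
for `i < T`, `∫_{0↔∞} deg_ω(0) · E ω T 0 ((Ψ(X_{i+1}) - Ψ(X_i))²) dP_{p_c} =
∫_{0↔∞} ∑_{y ∈ N_ω(0)} (y₀ + ψ(ω - y) - ψ(ω))² dP_{p_c}`.  Proof: PREFIX (`prefix_eq`), LAST STEP
with shift covariance (`last_step`), LINK (`StubPathFunctionalBasics.iterate_full`) and
STATIONARITY of the degree-biased cluster law (`stub_stationarity` for `g₂ / M`). -/
theorem stub_diagonalTerms :
    ∀ sh : Site 3 → BondConfig (Site 3) → BondConfig (Site 3),
      (∀ (x : Site 3) (ω : BondConfig (Site 3)),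
        sh x ω = BondConfig.relabel (sym2Equiv (Site.shift (-x))) ω) →
    ∀ Pop : BondConfig (Site 3) → (Site 3 → ℝ) → Site 3 → ℝ,
      (∀ ω (g : Site 3 → ℝ) (x : Site 3), Pop ω g x =
        (∑ y ∈ ((zdGraph 3).neighborFinset x).filter (fun y => s(x, y) ∈ ω), g y) /
          ((((zdGraph 3).neighborFinset x).filter (fun y => s(x, y) ∈ ω)).card : ℝ)) →
    ∀ E : BondConfig (Site 3) → ℕ → Site 3 → (List (Site 3) → ℝ) → ℝ,
      (∀ ω (x : Site 3) (G : List (Site 3) → ℝ), E ω 0 x G = G [x]) →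
      (∀ ω (T : ℕ) (x : Site 3) (G : List (Site 3) → ℝ), E ω (T + 1) x G =
        (∑ y ∈ ((zdGraph 3).neighborFinset x).filter (fun y => s(x, y) ∈ ω),
            E ω T y (fun l => G (x :: l))) /
          ((((zdGraph 3).neighborFinset x).filter (fun y => s(x, y) ∈ ω)).card : ℝ)) →
    ∀ (ψ : BondConfig (Site 3) → ℝ) (B : ℝ), Measurable ψ → (∀ ω, |ψ ω| ≤ B) →
    ∀ (T i : ℕ), i < T →
      ∫ ω in percolatesAt (0 : Site 3),
          ((((zdGraph 3).neighborFinset (0 : Site 3)).filter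
              (fun y => s((0 : Site 3), y) ∈ ω)).card : ℝ) *
            E ω T 0 (fun l =>
              ((((l.getD (i + 1) 0) 0 : ℤ) : ℝ) + ψ (sh (l.getD (i + 1) 0) ω) -
                ((((l.getD i 0) 0 : ℤ) : ℝ) + ψ (sh (l.getD i 0) ω))) ^ 2)
          ∂(bondPercolation (zdGraph 3) (criticalProbI 3)) =
        ∫ ω in percolatesAt (0 : Site 3),
          ∑ y ∈ ((zdGraph 3).neighborFinset (0 : Site 3)).filter (fun y => s((0 : Site 3), y) ∈ ω),
            (((y 0 : ℤ) : ℝ) + ψ (sh y ω) - ψ ω) ^ 2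
          ∂(bondPercolation (zdGraph 3) (criticalProbI 3))
    := by
  intro sh hsh Pop hPop E hE0 hEs ψ B hψm hψb T i hi
  obtain ⟨m, rfl⟩ : ∃ m, T = i + 1 + m := ⟨T - (i + 1), by omega⟩
  simp only [hsh]
  -- the open-neighbour structure is symmetric
  have hsymm : ∀ (ω : BondConfig (Site 3)) (x' y : Site 3),
      y ∈ ((zdGraph 3).neighborFinset x').filter (fun y => s(x', y) ∈ ω) →
      x' ∈ ((zdGraph 3).neighborFinset y).filter (fun y' => s(y, y') ∈ ω) := by
    intro ω x' y hy
    rw [Finset.mem_filter, SimpleGraph.mem_neighborFinset] at hy ⊢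
    exact ⟨hy.1.symm, by rw [Sym2.eq_swap]; exact hy.2⟩
  -- the normalising constant `M = (1 + 2B)² + 1` and `g₂ / M ∈ [0, 1]`, measurable
  obtain ⟨M, hM⟩ : ∃ M : ℝ, M = (1 + 2 * B) ^ 2 + 1 := ⟨_, rfl⟩
  have hM0 : 0 < M := by rw [hM]; positivity
  have hgm : Measurable fun ω : BondConfig (Site 3) =>
      (∑ w ∈ ((zdGraph 3).neighborFinset (0 : Site 3)).filter (fun w => s((0 : Site 3), w) ∈ ω),
          (((w 0 : ℤ) : ℝ) + ψ (BondConfig.relabel (sym2Equiv (Site.shift (-w))) ω) - ψ ω) ^ 2) /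
        ((((zdGraph 3).neighborFinset (0 : Site 3)).filter
          (fun w => s((0 : Site 3), w) ∈ ω)).card : ℝ) / M :=
    (measurable_sumSq_div hψm).div_const M
  have hgb : ∀ ω : BondConfig (Site 3),
      0 ≤ (∑ w ∈ ((zdGraph 3).neighborFinset (0 : Site 3)).filter (fun w => s((0 : Site 3), w) ∈ ω),
          (((w 0 : ℤ) : ℝ) + ψ (BondConfig.relabel (sym2Equiv (Site.shift (-w))) ω) - ψ ω) ^ 2) /
        ((((zdGraph 3).neighborFinset (0 : Site 3)).filter
          (fun w => s((0 : Site 3), w) ∈ ω)).card : ℝ) / M ∧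
      (∑ w ∈ ((zdGraph 3).neighborFinset (0 : Site 3)).filter (fun w => s((0 : Site 3), w) ∈ ω),
          (((w 0 : ℤ) : ℝ) + ψ (BondConfig.relabel (sym2Equiv (Site.shift (-w))) ω) - ψ ω) ^ 2) /
        ((((zdGraph 3).neighborFinset (0 : Site 3)).filter
          (fun w => s((0 : Site 3), w) ∈ ω)).card : ℝ) / M ≤ 1 := fun ω => by
    obtain ⟨h0, h1⟩ := sumSq_div_mem_Icc hψb ω
    exact ⟨div_nonneg h0 hM0.le, div_le_one_of_le₀ (h1.trans (by rw [hM]; linarith)) hM0.le⟩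
  -- pointwise identity on the left: PREFIX, LAST STEP, LINK, homogeneity
  have key : ∀ ω : BondConfig (Site 3),
      ((((zdGraph 3).neighborFinset (0 : Site 3)).filter
          (fun y => s((0 : Site 3), y) ∈ ω)).card : ℝ) *
        E ω (i + 1 + m) 0 (fun l =>
          ((((l.getD (i + 1) 0) 0 : ℤ) : ℝ) +
              ψ (BondConfig.relabel (sym2Equiv (Site.shift (-(l.getD (i + 1) 0)))) ω) -
            ((((l.getD i 0) 0 : ℤ) : ℝ) +
              ψ (BondConfig.relabel (sym2Equiv (Site.shift (-(l.getD i 0)))) ω))) ^ 2) =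
      M * (((((zdGraph 3).neighborFinset (0 : Site 3)).filter
          (fun y => s((0 : Site 3), y) ∈ ω)).card : ℝ) *
        ((Pop ω)^[i] (fun x =>
          (∑ w ∈ ((zdGraph 3).neighborFinset (0 : Site 3)).filter (fun w => s((0 : Site 3), w) ∈
              BondConfig.relabel (sym2Equiv (Site.shift (-x))) ω),
            (((w 0 : ℤ) : ℝ) +
                ψ (BondConfig.relabel (sym2Equiv (Site.shift (-w)))
                  (BondConfig.relabel (sym2Equiv (Site.shift (-x))) ω)) -
              ψ (BondConfig.relabel (sym2Equiv (Site.shift (-x))) ω)) ^ 2) /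
          ((((zdGraph 3).neighborFinset (0 : Site 3)).filter (fun w => s((0 : Site 3), w) ∈
              BondConfig.relabel (sym2Equiv (Site.shift (-x))) ω)).card : ℝ) / M)) 0) := by
    intro ω
    rcases (((zdGraph 3).neighborFinset (0 : Site 3)).filter
        (fun y => s((0 : Site 3), y) ∈ ω)).eq_empty_or_nonempty with h0 | hne
    · rw [h0, Finset.card_empty, Nat.cast_zero, zero_mul, zero_mul, mul_zero]
    · rw [mul_left_comm]
      refine congrArg₂ (· * ·) rfl ?_
      rw [prefix_eq (hE0 ω) (hEs ω) (hsymm ω) m (i + 1) 0]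
      · rw [last_step hE0 hEs ψ ω i,
          StubPathFunctionalBasics.iterate_full (v₀ := (0 : Site 3)) (hE0 ω) (hEs ω) (hPop ω) i _ 0,
          ← StubPathFunctionalBasics.smul (hE0 ω) (hEs ω) i 0 M]
        exact congrArg (E ω i 0) (funext fun l => (mul_div_cancel₀ _ hM0.ne').symm)
      · exact hne
      · intro l
        rw [getD_take_of_lt l 0 (show i + 1 < i + 1 + 1 by omega),
          getD_take_of_lt l 0 (show i < i + 1 + 1 by omega)]
  simp only [key]
  rw [integral_const_mul, stub_stationarity i _ hgm hgb Pop hPop, ← integral_const_mul]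
  refine setIntegral_congr_fun (measurableSet_percolatesAt_holds (0 : Site 3)) fun ω _ => ?_
  rw [mul_left_comm, mul_div_cancel₀ _ hM0.ne']
  exact StubPathReversal.card_mul_sum_div _ _

end Summit.CriticalPhenomena.PercolationContinuityZ3.Theorems.VerticalGamblersRuin
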